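import Summits.ResolutionOfSingularities.ResolutionOfSingularities.Theorems.FrobeniusLadderFInjectiveMacaulayficationWildPinchCylinderAxis
import Summits.ResolutionOfSingularities.ResolutionOfSingularities.Theorems.FrobeniusLadderFInjectiveMacaulayficationWildPinchCylinderFedder
import Summits.ResolutionOfSingularities.ResolutionOfSingularities.Theorems.FrobeniusLadderFInjectiveMacaulayficationStrictTransformNonClosed
import Summits.ResolutionOfSingularities.ResolutionOfSingularities.Theorems.FrobeniusLadderFInjectiveMacaulayficationRelClosedSubsetFixFinite
import Summits.ResolutionOfSingularities.ResolutionOfSingularities.Theorems.FrobeniusLadderFInjectiveMacaulayficationIsBlowupStalkOffSupport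
import Summits.ResolutionOfSingularities.ResolutionOfSingularities.Theorems.FrobeniusLadderFInjectiveMacaulayficationBadPointsClosed
import Literature.AlgebraicGeometry.Resolution.ExcellentBlowup
import Mathlib.AlgebraicGeometry.Morphisms.FiniteType
import Mathlib.AlgebraicGeometry.Morphisms.Separated
import Mathlib.AlgebraicGeometry.FunctionField
import HarnessLib

/-!
# WITNESS 2: the relative-agreement residual (T3) `RelClosedFix` is FALSE (unconditionally), and (T3-fin)/(T3′)/(T3′-pow) are false
# modulo the regular-blow-up datum (d4) on the t-axis (crux `FInjectiveMacaulayfication` stmt-ResolutionOfSingularities-15315, chain w45a;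
# the kill is res-L1-w45a-tri-2's KILL 2 `KILL-T3CLOSED.md` 21:22:12Z; res-L1-w45a-plan-1 R16.41 (2) / R16.42 (3) / R16.45; scheme half
# `…StrictTransformNonClosed` by res-L1-w45a-stub-2; algebra `…WildPinchCylinder{,Fedder,Axis}` and this assembly by res-L1-w45a-stub-3 g6)

[OURS · L1 W4.5a] Support file (`--supports stmt-ResolutionOfSingularities-15315 --as helper`); NOT a statement of any manuscript;
theorem-only, no named fact; AI-written (AI review is weaker than expert review). It REFUTES typed candidate statements of OURS — it does
not touch the crux `FInjectiveMacaulayfication` itself.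

THE MECHANISM (`exists_nonClosed_not_full`, §1). `X₁ = Spec R`, `R = 𝔽₂[u,t,y,v₁,v₂]/(y² + u²ty + ut²)` (the wild pinch point × 𝔸²),
`b` = origin, `B = V(u,t,y) ≅ 𝔸²` the pinch surface, whose generic point `η_B` is F-BAD (`WildPinchCylinderFedder.not_fCl_stalk_B`, Fedder).
Let `J` be ANY ideal sheaf with `b ∈ supp J` and `supp J ∩ B ⊆ {b}`, and `π : X₂ → X₁` ANY blow-up along `J`. Then `J·𝒪_{B,b}` is
`𝔪`-primary in the 2-dimensional regular `𝒪_{B,b}`, hence NOT principal (`WildPinchCylinderAxis.not_exists_stalkIdeal_comap_eq_span`, Krull),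
so the strict transform of `B` has a NON-closed point `ζ` over `b` with a generisation `η′` over `η_B`
(`StrictTransformNonClosed.exists_nonClosed_specializes`, stub-2); `𝒪_{X₂,η′} ≅ 𝒪_{X₁,η_B}` (`π` is an isomorphism off `supp J ∌ η_B`) is
F-bad, so `ζ` is NOT FULL (the clause localises, `BadPointsClosed.clause_of_specializes`). No cure of `J`-type is good at the non-closed
points over `b`.

* §2 **`relClosedFix_false : ¬ RelClosedSubsetFixFinite.RelClosedFix`** — UNCONDITIONAL. Witness `J₀ := 𝔪_b·𝒪` (support `{b}`): the
  hypothesis «good over `(supp J₀ ∩ W) ∖ {b}` = ∅» is VACUOUS, and the conclusion's `J ≡ J₀` off `b`, `b ∈ supp J`, good over `supp J ∩ W′ ∋ b`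
  is denied by §1.
* §3 (T3-fin)/(T3′)/(T3′-pow) with the NON-vacuous witness `J₀ := I_C` (t-axis), `Z := {b}`, MODULO the datum
  (d4) `GoodOverICOffOrigin` = «every blow-up along `I_C` is good over `C ∖ {b}`» (regular centre in the regular locus `t ≠ 0`; Liu 8.1.19 (a),
  tree `IsBlowup.isRegular_of_isRegular_subscheme`; being landed separately as `…WildPinchCylinderAxisGood`, res-L1-w45a-plan-1 R16.45 (3)):
  `relClosedSubsetFixFinite_false_of_goodOverIC`, `relClosedSubsetFix_false_of_goodOverIC`, `relClosedSubsetFixPow_false_of_goodOverIC`.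
[cite: Fedder1983, Thm. 1.12] [cite: StacksProject, Tag 02OS] [cite: Matsumura1987, Thm. 13.5]
-/

-- single-problem summit: the doubled namespace component is forced
set_option linter.dupNamespace false

noncomputable section

open MvPolynomial IsLocalRing AlgebraicGeometry CategoryTheory Literature.AlgebraicGeometry.Resolution

namespace Summit.ResolutionOfSingularities.ResolutionOfSingularities.Theorems.FInjectiveMacaulayfication.RelClosedFixFalse

open Summit.ResolutionOfSingularities.ResolutionOfSingularities.Theorems.FInjectiveMacaulayfication
open Summit.ResolutionOfSingularities.ResolutionOfSingularities.Theorems.FInjectiveMacaulayfication.SliceableCentre (CMCl FCl FullCl)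

/-! ## §1 The mechanism: no `J` cosupported on `B` exactly at `b` has a blow-up that is FULL at the non-closed points over `b` -/

section Core

variable (k : Type) [Field k] [CharP k 2] (F : MvPolynomial (Fin 5) k) (hF : F = X 2 ^ 2 + X 0 ^ 2 * X 1 * X 2 + X 0 * X 1 ^ 2)

include hF in
/-- **WITNESS 2, CORE.** On `X₁ = Spec R` (wild pinch cylinder, `char k = 2`): for every ideal sheaf `J` with `b ∈ supp J` (`b` = origin) and
`y ∉ supp J` for every other point `y` of the pinch surface `B` (`𝔮_{012} ≤ 𝔭_y ≠ 𝔮_{01234}`), and every blow-up `π : X₂ → X₁` along `J`,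
there is a NON-closed point `ζ ∈ X₂` over `b` at which `X₂` is NOT FULL. [cite: Fedder1983, Thm. 1.12] [cite: StacksProject, Tag 02OS] -/
theorem exists_nonClosed_not_full (J : (Spec (.of (MvPolynomial (Fin 5) k ⧸ Ideal.span {F}))).IdealSheafData)
    (b : Spec (.of (MvPolynomial (Fin 5) k ⧸ Ideal.span {F})))
    (hbI : b.asIdeal = (Ideal.span (MvPolynomial.X '' (Set.univ : Set (Fin 5)) : Set (MvPolynomial (Fin 5) k))).map
      (Ideal.Quotient.mk (Ideal.span {F})))
    (hb : b ∈ (J.support : Set (Spec (.of (MvPolynomial (Fin 5) k ⧸ Ideal.span {F})))))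
    (hoff : ∀ y : Spec (.of (MvPolynomial (Fin 5) k ⧸ Ideal.span {F})),
      (Ideal.span (MvPolynomial.X '' ({0, 1, 2} : Set (Fin 5)) : Set (MvPolynomial (Fin 5) k))).map (Ideal.Quotient.mk (Ideal.span {F})) ≤
        y.asIdeal →
      y.asIdeal ≠ (Ideal.span (MvPolynomial.X '' (Set.univ : Set (Fin 5)) : Set (MvPolynomial (Fin 5) k))).map
        (Ideal.Quotient.mk (Ideal.span {F})) →
      y ∉ (J.support : Set (Spec (.of (MvPolynomial (Fin 5) k ⧸ Ideal.span {F})))))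
    {X₂ : Scheme.{0}} (π : X₂ ⟶ Spec (.of (MvPolynomial (Fin 5) k ⧸ Ideal.span {F}))) (hπ : IsBlowup π J) :
    ∃ ζ : X₂, π.base ζ = b ∧ ¬ IsClosed ({ζ} : Set X₂) ∧ ¬ FullCl 2 (X₂.presheaf.stalk ζ) := by
  haveI := WildPinchCylinder.isDomain_quotient k F hF
  haveI := WildPinchCylinderAxis.isDomain_D' k
  haveI : Fact (Nat.Prime 2) := ⟨Nat.prime_two⟩
  -- the pinch surface `B ≅ 𝔸²` as a closed subscheme
  let B : Scheme.{0} := Spec (.of (MvPolynomial (Fin 5) k ⧸ Ideal.span (MvPolynomial.X '' ({0, 1, 2} : Set (Fin 5)) :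
    Set (MvPolynomial (Fin 5) k))))
  let i : B ⟶ Spec (.of (MvPolynomial (Fin 5) k ⧸ Ideal.span {F})) :=
    Spec.map (CommRingCat.ofHom (Ideal.Quotient.factor (WildPinchCylinderAxis.span_F_le_span_X012 k F hF)))
  haveI : IsClosedImmersion i := WildPinchCylinderAxis.isClosedImmersion_i k F hF
  haveI : IsIntegral B := inferInstance
  haveI : IsNoetherian B := inferInstance
  have hi : ∀ y : B, (i.base y).asIdeal = y.asIdeal.comap (Ideal.Quotient.factor (WildPinchCylinderAxis.span_F_le_span_X012 k F hF)) :=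
    fun y => rfl
  -- its origin `b_B ↦ b` and generic point `↦ η_B`
  let bB : B := ⟨(Ideal.span (MvPolynomial.X '' (Set.univ : Set (Fin 5)) : Set (MvPolynomial (Fin 5) k))).map (Ideal.Quotient.mk _),
    (WildPinchCylinderAxis.isPrime_map'_span_X k (Set.subset_univ _)).1⟩
  have hibB : i.base bB = b := by
    apply PrimeSpectrum.ext
    rw [hi, hbI]
    exact WildPinchCylinderAxis.comap_factor_map'_span_X k F hF (Set.subset_univ _)
  have hgen : (i.base (genericPoint B)).asIdeal =
      (Ideal.span (MvPolynomial.X '' ({0, 1, 2} : Set (Fin 5)) : Set (MvPolynomial (Fin 5) k))).map (Ideal.Quotient.mk (Ideal.span {F})) := by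
    rw [hi, show (genericPoint B).asIdeal = ⊥ by rw [genericPoint_eq_bot_of_affine]; rfl]
    exact WildPinchCylinderAxis.comap_factor_bot k F hF
  have hηB : i.base (genericPoint B) ∉ (J.support : Set _) := by
    refine hoff _ (le_of_eq hgen.symm) ?_
    rw [hgen]
    exact (WildPinchCylinder.map_span_X_lt k F hF (S := ({0, 1, 2} : Set (Fin 5))) (T := Set.univ) (by simp) (by simp) (Set.subset_univ _)
      (j := 3) (Set.mem_univ _) (by simp)).ne
  -- `J·𝒪_B ≠ ⊥`: at the generic point it is the unit ideal
  have hI : J.comap i ≠ ⊥ := by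
    intro h0
    have h1 : stalkIdeal (J.comap i) (genericPoint B) = ⊥ := by rw [h0]; exact stalkIdeal_bot _
    rw [stalkIdeal_comap_eq_map_stalkMap, (WildPinchCylinderAxis.stalkIdeal_eq_top_iff J _).mpr hηB, Ideal.map_top] at h1
    exact top_ne_bot h1
  -- `hb`: `J·𝒪_{B,b_B}` is not principal (Krull)
  have hb' : ¬ ∃ g : B.presheaf.stalk bB, stalkIdeal (J.comap i) bB = Ideal.span {g} :=
    WildPinchCylinderAxis.not_exists_stalkIdeal_comap_eq_span k F hF J bB rfl (by rw [show (Spec.map _).base bB = b from hibB]; exact hb) hoff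
  -- the strict transform of `B` has a non-closed point `ζ` over `b` with a generisation `η′` over `η_B` (stub-2)
  obtain ⟨η', ζ, hη', hζ, hspec, hncl⟩ :=
    StrictTransformNonClosed.exists_nonClosed_specializes hπ i (WildPinchCylinderAxis.isIntegrallyClosed_stalk_B k) hI bB hb'
  refine ⟨ζ, hζ.trans hibB, hncl, fun hfull => ?_⟩
  -- the clause localises from `ζ` to `η′` …
  haveI : IsLocallyNoetherian X₂ := hπ.isLocallyNoetherian'
  haveI : CharP (X₂.presheaf.stalk ζ) 2 :=
    CharP.of_ringHom_of_ne_zero ((π.stalkMap ζ).hom.comp (((Spec (.of (MvPolynomial (Fin 5) k ⧸ Ideal.span {F}))).presheaf.germ ⊤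
      (π.base ζ) trivial).hom.comp ((Scheme.ΓSpecIso (.of (MvPolynomial (Fin 5) k ⧸ Ideal.span {F}))).inv.hom.comp
        ((Ideal.Quotient.mk (Ideal.span {F})).comp MvPolynomial.C)))) 2 two_ne_zero
  have hcl := BadPointsClosed.clause_of_specializes 2 hspec hfull.2
  -- … where the stalk is that of `X₁` at `η_B`, which is F-bad
  haveI := IsBlowupStalkOffSupport.isIso_stalkMap_of_not_mem_support hπ η' (by rw [hη']; exact hηB)
  exact WildPinchCylinderFedder.not_clause_of_ringEquiv_stalk_B k F hF (π.base η') (by rw [hη']; exact hgen)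
    (asIso (π.stalkMap η')).commRingCatIsoToRingEquiv.symm hcl

end Core

/-! ## §2 (T3) `RelClosedFix` is FALSE — unconditional, witness `J₀ = 𝔪_b` -/

/-- **(T3) `RelClosedFix` IS FALSE.** Witness: `k = 𝔽₂`, `X₁ = Spec k[u,t,y,v₁,v₂]/(y² + u²ty + ut²)` (integral, 4-dimensional, all stalks
CM), `b` = origin, `J₀ := 𝔪_b·𝒪_{X₁}` (support `{b}`). The hypothesis «`J₀` good over `(supp J₀ ∩ W) ∖ {b}`» is vacuous (`W := X₁`); a
conclusion `J ≡ J₀` off `b`, `b ∈ supp J`, good over `supp J ∩ W′ ∋ b` would make SOME blow-up along `J` FULL at every non-closed point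
over `b` — denied by `exists_nonClosed_not_full` (`supp J ∩ B = {b}` since `J = J₀ = ⊤` on `B ∖ {b}`). [cite: Fedder1983, Thm. 1.12]
[cite: StacksProject, Tag 02OS] -/
theorem relClosedFix_false : ¬ RelClosedSubsetFixFinite.RelClosedFix := by
  intro h
  -- the witness scheme (as in `RelClosedSubsetFixPowFalseOfW.relClosedSubsetFixPow_false_of_W`)
  let k : Type := ZMod 2
  let F : MvPolynomial (Fin 5) k := X 2 ^ 2 + X 0 ^ 2 * X 1 * X 2 + X 0 * X 1 ^ 2
  have hF : F = X 2 ^ 2 + X 0 ^ 2 * X 1 * X 2 + X 0 * X 1 ^ 2 := rfl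
  let R : Type := MvPolynomial (Fin 5) k ⧸ Ideal.span {F}
  haveI : IsDomain R := WildPinchCylinder.isDomain_quotient k F hF
  let X₁ : Scheme.{0} := Spec (.of R)
  let mk : MvPolynomial (Fin 5) k →+* R := Ideal.Quotient.mk (Ideal.span {F})
  let f₁ : X₁ ⟶ Spec (.of k) := Spec.map (CommRingCat.ofHom (algebraMap k R))
  have hft : LocallyOfFiniteType f₁ :=
    (HasRingHomProperty.Spec_iff (P := @LocallyOfFiniteType)).mpr (RingHom.finiteType_algebraMap.mpr inferInstance)
  have hsep : IsSeparated f₁ := inferInstance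
  have hqc : QuasiCompact f₁ := inferInstance
  have hint : IsIntegral X₁ := inferInstance
  have estalk : ∀ x : X₁, X₁.presheaf.stalk x ≃+* Localization.AtPrime x.asIdeal := fun x =>
    (Spec.stalkIso (.of R) x).commRingCatIsoToRingEquiv
  have h4 : 4 ≤ topologicalKrullDim X₁ := by
    rw [show topologicalKrullDim X₁ = ringKrullDim R from PrimeSpectrum.topologicalKrullDim_eq_ringKrullDim R]
    exact WildPinchCylinder.four_le_ringKrullDim k F hF
  have hCM : ∀ x : X₁, CMCl (X₁.presheaf.stalk x) := fun x =>
    FiLocusOpenOfAffine.cmClause_of_ringEquiv (estalk x).symm (WildPinchCylinder.cmClause_localization k F hF x.asIdeal)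
  -- the origin `b` and `J₀ = 𝔪_b·𝒪`
  let P : Set (Fin 5) → Ideal R := fun S => (Ideal.span (MvPolynomial.X '' S : Set (MvPolynomial (Fin 5) k))).map mk
  have hmax : (P Set.univ).IsMaximal := WildPinchCylinderAxis.isMaximal_P_univ k F hF
  let b : X₁ := ⟨P Set.univ, hmax.isPrime⟩
  have hbcl : IsClosed ({b} : Set X₁) := (PrimeSpectrum.isClosed_singleton_iff_isMaximal b).mpr hmax
  let J₀ : X₁.IdealSheafData := Scheme.IdealSheafData.ofIdealTop ((P Set.univ).map (Scheme.ΓSpecIso (.of R)).inv.hom)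
  have hsupp : ∀ x : X₁, x ∈ (J₀.support : Set X₁) ↔ P Set.univ ≤ x.asIdeal := fun x =>
    WildPinchCylinderAxis.mem_support_ofIdealTop_map_iff _ x
  have hbJ₀ : b ∈ (J₀.support : Set X₁) := (hsupp b).mpr le_rfl
  have honly : ∀ x : X₁, x ∈ (J₀.support : Set X₁) → x = b := fun x hx =>
    PrimeSpectrum.ext (hmax.eq_of_le x.2.ne_top ((hsupp x).mp hx)).symm
  -- the hypothesis of (T3) is vacuous
  have hyp : ∃ W : X₁.Opens, b ∈ (W : Set X₁) ∧
      FCUnguardedAprime.GoodOver 2 X₁ J₀ ((((J₀.support : Set X₁)) ∩ (W : Set X₁)) \ {b}) := by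
    refine ⟨⊤, trivial, fun X₂ π _ => ⟨fun x hx _ => ?_, fun x hx _ => ?_⟩⟩
    · exact absurd (honly _ hx.1.1) hx.2
    · exact absurd (honly _ hx.1.1) hx.2
  -- apply (T3)
  obtain ⟨J, W', hbW', hbJ, hJeq, hJgood⟩ := h 2 Nat.prime_two k X₁ f₁ hsep hft hqc hint h4 hCM J₀ b hbcl hbJ₀ hyp
  -- `J = J₀ = ⊤` on `B ∖ {b}`
  have hoff : ∀ y : X₁, P {0, 1, 2} ≤ y.asIdeal → y.asIdeal ≠ P Set.univ → y ∉ (J.support : Set X₁) := by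
    intro y _ hyb
    have hne : y ≠ b := fun heq => hyb (by rw [heq])
    rw [← WildPinchCylinderAxis.stalkIdeal_eq_top_iff, hJeq y hne, WildPinchCylinderAxis.stalkIdeal_eq_top_iff]
    exact fun hy => hne (honly y hy)
  -- some blow-up along `J`, and its bad non-closed point over `b`
  obtain ⟨X₂, π, hπ⟩ := exists_isBlowup X₁ J
  obtain ⟨ζ, hζb, hncl, hbad⟩ := exists_nonClosed_not_full k F hF J b rfl hbJ hoff π hπ
  exact hbad ((hJgood X₂ π hπ).1 ζ ⟨by rw [hζb]; exact hbJ, by rw [hζb]; exact hbW'⟩ hncl)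

/-! ## §3 (T3-fin)/(T3′)/(T3′-pow) with `J₀ = I_C` (t-axis), `Z = {b}`, modulo the regular-blow-up datum (d4) -/

section AxisWitness

variable (k : Type) [Field k] [CharP k 2] (F : MvPolynomial (Fin 5) k) (hF : F = X 2 ^ 2 + X 0 ^ 2 * X 1 * X 2 + X 0 * X 1 ^ 2)

include hF in
/-- **No power-cure of `I_C` at the origin.** If `J ≡ I_Cⁿ` (`n > 0`) at every point `≠ b`, then `b ∈ supp J` (closure of the generic
point `γ_C` of `C`, where `J_γ = I_{C,γ}ⁿ ≠ ⊤`) and `supp J ∩ B = {b}` (`I_C = ⊤` on `B ∖ {b}`), so by `exists_nonClosed_not_full` NO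
blow-up along `J` is good over `supp J`. [cite: Fedder1983, Thm. 1.12] [cite: StacksProject, Tag 02OS] -/
theorem not_goodOver_of_eq_IC_pow (b : Spec (.of (MvPolynomial (Fin 5) k ⧸ Ideal.span {F})))
    (hbI : b.asIdeal = (Ideal.span (MvPolynomial.X '' (Set.univ : Set (Fin 5)) : Set (MvPolynomial (Fin 5) k))).map
      (Ideal.Quotient.mk (Ideal.span {F})))
    (J : (Spec (.of (MvPolynomial (Fin 5) k ⧸ Ideal.span {F}))).IdealSheafData) (n : ℕ) (hn : 0 < n)
    (hJeq : ∀ x : Spec (.of (MvPolynomial (Fin 5) k ⧸ Ideal.span {F})), x ≠ b →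
      stalkIdeal J x = stalkIdeal (Scheme.IdealSheafData.ofIdealTop (((Ideal.span (MvPolynomial.X '' ({0, 2, 3, 4} : Set (Fin 5)) :
        Set (MvPolynomial (Fin 5) k))).map (Ideal.Quotient.mk (Ideal.span {F}))).map
          (Scheme.ΓSpecIso (.of (MvPolynomial (Fin 5) k ⧸ Ideal.span {F}))).inv.hom)) x ^ n) :
    ¬ FCUnguardedAprime.GoodOver 2 (Spec (.of (MvPolynomial (Fin 5) k ⧸ Ideal.span {F}))) J
      (J.support : Set (Spec (.of (MvPolynomial (Fin 5) k ⧸ Ideal.span {F})))) := by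
  haveI := WildPinchCylinder.isDomain_quotient k F hF
  intro hJgood
  -- the generic point `γ_C` of the t-axis lies in `supp J`, hence so does `b`
  let γ : Spec (.of (MvPolynomial (Fin 5) k ⧸ Ideal.span {F})) :=
    ⟨(Ideal.span (MvPolynomial.X '' ({0, 2, 3, 4} : Set (Fin 5)) : Set (MvPolynomial (Fin 5) k))).map (Ideal.Quotient.mk (Ideal.span {F})),
      (WildPinchCylinder.isPrime_map_span_X k F hF (S := ({0, 2, 3, 4} : Set (Fin 5))) (by simp) (by simp)).1⟩
  have hγb : γ ⤳ b := by
    rw [WildPinchCylinderAxis.specializes_iff_le, hbI]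
    exact Ideal.map_mono (Ideal.span_mono (Set.image_mono (Set.subset_univ _)))
  have hγne : γ ≠ b := by
    intro heq
    have hlt := WildPinchCylinder.map_span_X_lt k F hF (S := ({0, 2, 3, 4} : Set (Fin 5))) (T := Set.univ) (by simp) (by simp)
      (Set.subset_univ _) (j := 1) (Set.mem_univ _) (by simp)
    exact hlt.ne (show γ.asIdeal = _ by rw [heq, hbI])
  have hγC : γ ∈ ((Scheme.IdealSheafData.ofIdealTop (((Ideal.span (MvPolynomial.X '' ({0, 2, 3, 4} : Set (Fin 5)) :
        Set (MvPolynomial (Fin 5) k))).map (Ideal.Quotient.mk (Ideal.span {F}))).map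
          (Scheme.ΓSpecIso (.of (MvPolynomial (Fin 5) k ⧸ Ideal.span {F}))).inv.hom)).support : Set _) :=
    (WildPinchCylinderAxis.mem_support_IC_iff k F γ).mpr le_rfl
  have hγJ : γ ∈ (J.support : Set _) := by
    have h := (mem_support_iff_stalkIdeal_le _ γ).mp hγC
    change γ ∈ J.support
    rw [mem_support_iff_stalkIdeal_le, hJeq γ hγne]
    obtain ⟨m, rfl⟩ := Nat.exists_eq_succ_of_ne_zero hn.ne'
    exact (Ideal.IsPrime.pow_le_iff m.succ_ne_zero).mpr h
  have hbJ : b ∈ (J.support : Set _) := hγb.mem_closed J.support.isClosed hγJ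
  -- `J = I_Cⁿ = ⊤` on `B ∖ {b}`
  have hoff : ∀ y : Spec (.of (MvPolynomial (Fin 5) k ⧸ Ideal.span {F})),
      (Ideal.span (MvPolynomial.X '' ({0, 1, 2} : Set (Fin 5)) : Set (MvPolynomial (Fin 5) k))).map (Ideal.Quotient.mk (Ideal.span {F})) ≤
        y.asIdeal →
      y.asIdeal ≠ (Ideal.span (MvPolynomial.X '' (Set.univ : Set (Fin 5)) : Set (MvPolynomial (Fin 5) k))).map
        (Ideal.Quotient.mk (Ideal.span {F})) → y ∉ (J.support : Set _) := by
    intro y hB hyb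
    have hne : y ≠ b := fun heq => hyb (by rw [heq, hbI])
    exact WildPinchCylinderAxis.not_mem_support_of_eq_IC_pow_on_B k F hF J n y hB hyb (hJeq y hne)
  -- a blow-up along `J` and its bad non-closed point over `b ∈ supp J`
  obtain ⟨X₂, π, hπ⟩ := exists_isBlowup _ J
  obtain ⟨ζ, hζb, hncl, hbad⟩ := exists_nonClosed_not_full k F hF J b hbI hbJ hoff π hπ
  exact hbad ((hJgood X₂ π hπ).1 ζ (by rw [hζb]; exact hbJ) hncl)

end AxisWitness

/-- **(T3′-pow) `RelClosedSubsetFixPow` is FALSE modulo (d4).** Witness `J₀ := I_C`, `Z := {b}`: the hypothesis «good over `supp I_C ∖ {b}`»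
is (d4); the conclusion `J ≡ I_Cⁿ` off `b`, good over `supp J`, is denied by `not_goodOver_of_eq_IC_pow`. [cite: Fedder1983, Thm. 1.12] -/
theorem relClosedSubsetFixPow_false_of_goodOverIC
    (hd4 : ∀ (k : Type) [Field k] [CharP k 2] (F : MvPolynomial (Fin 5) k), F = X 2 ^ 2 + X 0 ^ 2 * X 1 * X 2 + X 0 * X 1 ^ 2 →
      ∀ b : Spec (.of (MvPolynomial (Fin 5) k ⧸ Ideal.span {F})),
        b.asIdeal = (Ideal.span (MvPolynomial.X '' (Set.univ : Set (Fin 5)) : Set (MvPolynomial (Fin 5) k))).map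
          (Ideal.Quotient.mk (Ideal.span {F})) →
        FCUnguardedAprime.GoodOver 2 (Spec (.of (MvPolynomial (Fin 5) k ⧸ Ideal.span {F})))
          (Scheme.IdealSheafData.ofIdealTop (((Ideal.span (MvPolynomial.X '' ({0, 2, 3, 4} : Set (Fin 5)) :
            Set (MvPolynomial (Fin 5) k))).map (Ideal.Quotient.mk (Ideal.span {F}))).map
              (Scheme.ΓSpecIso (.of (MvPolynomial (Fin 5) k ⧸ Ideal.span {F}))).inv.hom))
          ((((Scheme.IdealSheafData.ofIdealTop (((Ideal.span (MvPolynomial.X '' ({0, 2, 3, 4} : Set (Fin 5)) :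
            Set (MvPolynomial (Fin 5) k))).map (Ideal.Quotient.mk (Ideal.span {F}))).map
              (Scheme.ΓSpecIso (.of (MvPolynomial (Fin 5) k ⧸ Ideal.span {F}))).inv.hom)).support :
                Set (Spec (.of (MvPolynomial (Fin 5) k ⧸ Ideal.span {F}))))) \ {b})) :
    ¬ FCUnguardedAprime.RelClosedSubsetFixPow := by
  intro h
  let k : Type := ZMod 2
  let F : MvPolynomial (Fin 5) k := X 2 ^ 2 + X 0 ^ 2 * X 1 * X 2 + X 0 * X 1 ^ 2
  have hF : F = X 2 ^ 2 + X 0 ^ 2 * X 1 * X 2 + X 0 * X 1 ^ 2 := rfl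
  let R : Type := MvPolynomial (Fin 5) k ⧸ Ideal.span {F}
  haveI : IsDomain R := WildPinchCylinder.isDomain_quotient k F hF
  let X₁ : Scheme.{0} := Spec (.of R)
  let mk : MvPolynomial (Fin 5) k →+* R := Ideal.Quotient.mk (Ideal.span {F})
  let f₁ : X₁ ⟶ Spec (.of k) := Spec.map (CommRingCat.ofHom (algebraMap k R))
  have hft : LocallyOfFiniteType f₁ :=
    (HasRingHomProperty.Spec_iff (P := @LocallyOfFiniteType)).mpr (RingHom.finiteType_algebraMap.mpr inferInstance)
  have hsep : IsSeparated f₁ := inferInstance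
  have hqc : QuasiCompact f₁ := inferInstance
  have hint : IsIntegral X₁ := inferInstance
  have estalk : ∀ x : X₁, X₁.presheaf.stalk x ≃+* Localization.AtPrime x.asIdeal := fun x =>
    (Spec.stalkIso (.of R) x).commRingCatIsoToRingEquiv
  have h4 : 4 ≤ topologicalKrullDim X₁ := by
    rw [show topologicalKrullDim X₁ = ringKrullDim R from PrimeSpectrum.topologicalKrullDim_eq_ringKrullDim R]
    exact WildPinchCylinder.four_le_ringKrullDim k F hF
  have hCM : ∀ x : X₁, CMCl (X₁.presheaf.stalk x) := fun x =>
    FiLocusOpenOfAffine.cmClause_of_ringEquiv (estalk x).symm (WildPinchCylinder.cmClause_localization k F hF x.asIdeal)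
  -- the origin `b`, the centre `I_C`, `Z = {b}`
  let P : Set (Fin 5) → Ideal R := fun S => (Ideal.span (MvPolynomial.X '' S : Set (MvPolynomial (Fin 5) k))).map mk
  have hmax : (P Set.univ).IsMaximal := WildPinchCylinderAxis.isMaximal_P_univ k F hF
  let b : X₁ := ⟨P Set.univ, hmax.isPrime⟩
  have hbcl : IsClosed ({b} : Set X₁) := (PrimeSpectrum.isClosed_singleton_iff_isMaximal b).mpr hmax
  let IC : X₁.IdealSheafData := Scheme.IdealSheafData.ofIdealTop ((P {0, 2, 3, 4}).map (Scheme.ΓSpecIso (.of R)).inv.hom)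
  have hbC : ({b} : Set X₁) ⊆ (IC.support : Set X₁) := by
    rw [Set.singleton_subset_iff]
    exact (WildPinchCylinderAxis.mem_support_IC_iff k F b).mpr (Ideal.map_mono (Ideal.span_mono (Set.image_mono (Set.subset_univ _))))
  -- apply the residual to the datum (d4)
  obtain ⟨J, n, hn, hJeq, hJgood⟩ := h 2 Nat.prime_two k X₁ f₁ hsep hft hqc hint h4 hCM IC {b} hbcl hbC (hd4 k F hF b rfl)
  exact not_goodOver_of_eq_IC_pow k F hF b rfl J n hn (fun x hx => hJeq x hx) hJgood

/-- **(T3-fin) `RelClosedSubsetFixFinite` is FALSE modulo (d4)** (same witness, `Z = {b}` finite, exact agreement `n = 1`).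
[cite: Fedder1983, Thm. 1.12] -/
theorem relClosedSubsetFixFinite_false_of_goodOverIC
    (hd4 : ∀ (k : Type) [Field k] [CharP k 2] (F : MvPolynomial (Fin 5) k), F = X 2 ^ 2 + X 0 ^ 2 * X 1 * X 2 + X 0 * X 1 ^ 2 →
      ∀ b : Spec (.of (MvPolynomial (Fin 5) k ⧸ Ideal.span {F})),
        b.asIdeal = (Ideal.span (MvPolynomial.X '' (Set.univ : Set (Fin 5)) : Set (MvPolynomial (Fin 5) k))).map
          (Ideal.Quotient.mk (Ideal.span {F})) →
        FCUnguardedAprime.GoodOver 2 (Spec (.of (MvPolynomial (Fin 5) k ⧸ Ideal.span {F})))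
          (Scheme.IdealSheafData.ofIdealTop (((Ideal.span (MvPolynomial.X '' ({0, 2, 3, 4} : Set (Fin 5)) :
            Set (MvPolynomial (Fin 5) k))).map (Ideal.Quotient.mk (Ideal.span {F}))).map
              (Scheme.ΓSpecIso (.of (MvPolynomial (Fin 5) k ⧸ Ideal.span {F}))).inv.hom))
          ((((Scheme.IdealSheafData.ofIdealTop (((Ideal.span (MvPolynomial.X '' ({0, 2, 3, 4} : Set (Fin 5)) :
            Set (MvPolynomial (Fin 5) k))).map (Ideal.Quotient.mk (Ideal.span {F}))).map
              (Scheme.ΓSpecIso (.of (MvPolynomial (Fin 5) k ⧸ Ideal.span {F}))).inv.hom)).support :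
                Set (Spec (.of (MvPolynomial (Fin 5) k ⧸ Ideal.span {F}))))) \ {b})) :
    ¬ RelClosedSubsetFixFinite.RelClosedSubsetFixFinite := by
  intro h
  let k : Type := ZMod 2
  let F : MvPolynomial (Fin 5) k := X 2 ^ 2 + X 0 ^ 2 * X 1 * X 2 + X 0 * X 1 ^ 2
  have hF : F = X 2 ^ 2 + X 0 ^ 2 * X 1 * X 2 + X 0 * X 1 ^ 2 := rfl
  let R : Type := MvPolynomial (Fin 5) k ⧸ Ideal.span {F}
  haveI : IsDomain R := WildPinchCylinder.isDomain_quotient k F hF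
  let X₁ : Scheme.{0} := Spec (.of R)
  let mk : MvPolynomial (Fin 5) k →+* R := Ideal.Quotient.mk (Ideal.span {F})
  let f₁ : X₁ ⟶ Spec (.of k) := Spec.map (CommRingCat.ofHom (algebraMap k R))
  have hft : LocallyOfFiniteType f₁ :=
    (HasRingHomProperty.Spec_iff (P := @LocallyOfFiniteType)).mpr (RingHom.finiteType_algebraMap.mpr inferInstance)
  have hsep : IsSeparated f₁ := inferInstance
  have hqc : QuasiCompact f₁ := inferInstance
  have hint : IsIntegral X₁ := inferInstance
  have estalk : ∀ x : X₁, X₁.presheaf.stalk x ≃+* Localization.AtPrime x.asIdeal := fun x =>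
    (Spec.stalkIso (.of R) x).commRingCatIsoToRingEquiv
  have h4 : 4 ≤ topologicalKrullDim X₁ := by
    rw [show topologicalKrullDim X₁ = ringKrullDim R from PrimeSpectrum.topologicalKrullDim_eq_ringKrullDim R]
    exact WildPinchCylinder.four_le_ringKrullDim k F hF
  have hCM : ∀ x : X₁, CMCl (X₁.presheaf.stalk x) := fun x =>
    FiLocusOpenOfAffine.cmClause_of_ringEquiv (estalk x).symm (WildPinchCylinder.cmClause_localization k F hF x.asIdeal)
  let P : Set (Fin 5) → Ideal R := fun S => (Ideal.span (MvPolynomial.X '' S : Set (MvPolynomial (Fin 5) k))).map mk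
  have hmax : (P Set.univ).IsMaximal := WildPinchCylinderAxis.isMaximal_P_univ k F hF
  let b : X₁ := ⟨P Set.univ, hmax.isPrime⟩
  have hbcl : IsClosed ({b} : Set X₁) := (PrimeSpectrum.isClosed_singleton_iff_isMaximal b).mpr hmax
  let IC : X₁.IdealSheafData := Scheme.IdealSheafData.ofIdealTop ((P {0, 2, 3, 4}).map (Scheme.ΓSpecIso (.of R)).inv.hom)
  have hbC : ({b} : Set X₁) ⊆ (IC.support : Set X₁) := by
    rw [Set.singleton_subset_iff]
    exact (WildPinchCylinderAxis.mem_support_IC_iff k F b).mpr (Ideal.map_mono (Ideal.span_mono (Set.image_mono (Set.subset_univ _))))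
  obtain ⟨J, hJeq, hJgood⟩ := h 2 Nat.prime_two k X₁ f₁ hsep hft hqc hint h4 hCM IC {b} hbcl (Set.finite_singleton b) hbC (hd4 k F hF b rfl)
  exact not_goodOver_of_eq_IC_pow k F hF b rfl J 1 Nat.one_pos (fun x hx => by rw [pow_one]; exact hJeq x hx) hJgood

/-- **(T3′) `RelClosedSubsetFix` is FALSE modulo (d4)** (it implies (T3-fin), `RelClosedSubsetFixFinite.relClosedSubsetFixFinite_of_relClosedSubsetFix`).
[plumbing] -/
theorem relClosedSubsetFix_false_of_goodOverIC
    (hd4 : ∀ (k : Type) [Field k] [CharP k 2] (F : MvPolynomial (Fin 5) k), F = X 2 ^ 2 + X 0 ^ 2 * X 1 * X 2 + X 0 * X 1 ^ 2 →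
      ∀ b : Spec (.of (MvPolynomial (Fin 5) k ⧸ Ideal.span {F})),
        b.asIdeal = (Ideal.span (MvPolynomial.X '' (Set.univ : Set (Fin 5)) : Set (MvPolynomial (Fin 5) k))).map
          (Ideal.Quotient.mk (Ideal.span {F})) →
        FCUnguardedAprime.GoodOver 2 (Spec (.of (MvPolynomial (Fin 5) k ⧸ Ideal.span {F})))
          (Scheme.IdealSheafData.ofIdealTop (((Ideal.span (MvPolynomial.X '' ({0, 2, 3, 4} : Set (Fin 5)) :
            Set (MvPolynomial (Fin 5) k))).map (Ideal.Quotient.mk (Ideal.span {F}))).map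
              (Scheme.ΓSpecIso (.of (MvPolynomial (Fin 5) k ⧸ Ideal.span {F}))).inv.hom))
          ((((Scheme.IdealSheafData.ofIdealTop (((Ideal.span (MvPolynomial.X '' ({0, 2, 3, 4} : Set (Fin 5)) :
            Set (MvPolynomial (Fin 5) k))).map (Ideal.Quotient.mk (Ideal.span {F}))).map
              (Scheme.ΓSpecIso (.of (MvPolynomial (Fin 5) k ⧸ Ideal.span {F}))).inv.hom)).support :
                Set (Spec (.of (MvPolynomial (Fin 5) k ⧸ Ideal.span {F}))))) \ {b})) :
    ¬ FCUnguardedAprime.RelClosedSubsetFix := fun h =>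
  relClosedSubsetFixFinite_false_of_goodOverIC hd4 (RelClosedSubsetFixFinite.relClosedSubsetFixFinite_of_relClosedSubsetFix h)

end Summit.ResolutionOfSingularities.ResolutionOfSingularities.Theorems.FInjectiveMacaulayfication.RelClosedFixFalse

end
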